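import Summits.BirchSwinnertonDyer.BirchSwinnertonDyer.Theorems.KolyvaginRankRigidityAtTwoAdmissibleAtTwo
import Summits.BirchSwinnertonDyer.BirchSwinnertonDyer.Theorems.KatoDescentTamePotSupersingularJetchevIrreducibleReadingSignUnconditional
import Summits.BirchSwinnertonDyer.BirchSwinnertonDyer.Theorems.KolyvaginRankRigidityAtTwoOffHabitatIrredKolyvaginRelationAtTwo
import HarnessLib

/-!
# Route `KolyvaginRankRigidityAtTwo`, residual crux R_irr `OffHabitatIrredNonSurjTwoConverse`
# (stmt-BirchSwinnertonDyer-27123, LINE 8): T3 «CONJUGATION SIGN» OFF THE HABITAT —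
# `τ_* c_M(n) = ε c_M(n)`, `ε = −w(E)·(−1)^ν`, from `E(ℚ)[2] = 0` (helper, PROVED, unconditional;
# width seat `bsd-line-krr2-p2` g9)

The habitat T3 (`stub_conjSign` / `conjAct_kolyvaginClass_two_eq_sign_smul`, Gross 1991 Prop. 5.4 for
the concrete class at `p = 2`) uses the image only through the `hA` binder at every divisor of the
conductor (`KolyvaginAtTwo.isAdmissible_pointsSubgroup_two_of_heegner … (hρ 1)`). With the off-habitat
`hA` supply `GenusExact.isAdmissible_pointsSubgroup_two_of_torsionBy_eq_bot` (landed this generation: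
`E(ℚ)[2] = 0`, `d_K ≠ −4`, Heegner; any level) the same sign law holds on the frame of R_irr — the
eigen-sign input of the finite-index one-class Čebotarev theorem
(`exists_kolyvaginPrime_gt_two_eigenclass_offHabitat`, hypothesis `hκ : conjAct … κ = ε • κ`).

* `conjAct_kolyvaginClass_two_eq_sign_smul_offHabitat` — one conductor, `hs` replaced by `E(ℚ)[2] = 0`;
* `conjSign_offHabitat` — T3's text with the binder `(∀ m, ρ̄_{E,2^m} onto)` replaced by `E(ℚ)[2] = 0`.

HONEST FRAMING: helper (`--supports` 27123); nothing here closes R_irr; BSD is NOT proved by any of this.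

References: [GrossLMS1991] §5 Prop. 5.3, Prop. 5.4 (1)–(2) (p. 243), Lemma 4.3; [McCallumLMS1991] §5
(ε_r = (−1)^r ε); [WZhang2014] Notations (xii).
-/

set_option autoImplicit false
-- the Theorems namespace of this sub repeats the summit name by design (D-0017 nested layout)
set_option linter.dupNamespace false

noncomputable section

open scoped Classical

open WeierstrassCurve Literature.NumberTheory.EllipticCurves
  Literature.NumberTheory.EllipticCurves.ModularForms NumberField IsDedekindDomain
open Summit.BirchSwinnertonDyer.Rank1Residual.X11b Summit.BirchSwinnertonDyer.Rank1Residual.JET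

namespace Summit.BirchSwinnertonDyer.BirchSwinnertonDyer.Theorems.KolyvaginLowerBoundAtTwo

section OneConductor

-- `K : Type`: the tree's ring-class class field theory is universe `0`.
variable {K : Type} [Field K] [NumberField K] {W : WeierstrassCurve ℚ}

/-- **Gross 1991 Prop. 5.4 for the concrete class AT `p = 2`, one conductor, OFF THE HABITAT**: for
`E/ℚ` globally minimal with `E(ℚ)[2] = 0` (any `2`-adic image), `K` imaginary quadratic with odd
`d_K ∉ {−3, −4}` and the Heegner hypothesis, the non-trivial `τ ∈ Aut(K/ℚ)`, a frame, a square-free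
conductor `c` of Zhang–Kolyvagin primes at `2` of index `≥ k ≥ 1`, and ANY datum `d` of conductor `c`:
`τ_* c_k(c) = (−w(E)·(−1)^{#primes of c}) • c_k(c)`. The habitat proof verbatim, with the admissibility
at `2` from `GenusExact.isAdmissible_pointsSubgroup_two_of_torsionBy_eq_bot`.
[cite: GrossLMS1991, §5 Prop. 5.3, Prop. 5.4 (1)–(2) (p. 243)] [cite: McCallumLMS1991, §5 (ε_r = (−1)^r ε)] -/
theorem conjAct_kolyvaginClass_two_eq_sign_smul_offHabitat [W.IsElliptic] [W.IsGloballyMinimal]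
    [NeZero (W.conductorNorm ℤ)] (htorQ : AddSubgroup.torsionBy W.toAffine.Point (2 : ℤ) = ⊥)
    (hK : IsImaginaryQuadratic K) (hD3 : NumberField.discr K ≠ -3) (hD4 : NumberField.discr K ≠ -4)
    (hH : SatisfiesHeegnerHypothesis (W.conductorNorm ℤ) K)
    (τ : K ≃ₐ[ℚ] K) (hτ : τ ≠ 1)
    (Dt : ModularParametrizationData W (W.conductorNorm ℤ)) (β : ℤ) (ι : K →+* ℂ)
    {c : ℕ} (hc : Squarefree c) {k : ℕ} (hk : 1 ≤ k)
    (hcK : ∀ ℓ ∈ c.primeFactors, Zhang2014.IsKolyvaginPrime (W.conductorNorm ℤ) W K 2 ℓ ∧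
      k ≤ Zhang2014.kolyvaginIndex W 2 ℓ)
    (d : KolyvaginHeegnerData Dt β ι c) :
    conjAct W τ ((2 ^ k : ℕ) : ℤ) (d.kolyvaginClass Nat.prime_two k) =
      (-W.rootNumber * (-1) ^ c.primeFactors.card) • d.kolyvaginClass Nat.prime_two k := by
  have hCM1 : phi_heegnerPointOfConductor_mem_range_map_ringClassField (W.conductorNorm ℤ) W K :=
    phi_heegnerPointOfConductor_mem_range_map_ringClassField_holds (W.conductorNorm ℤ) W K
  have hCM2 : exists_generator_ringClassGalOver K := exists_generator_ringClassGalOver_holds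
  have hND : IsCoprime (W.conductorNorm ℤ : ℤ) (NumberField.discr K) :=
    KolyvaginAssembly.isCoprime_discr_of_satisfiesHeegnerHypothesis hK hH
  have hD : NumberField.discr K < -4 := KolyvaginAssembly.discr_lt_neg_four hK ⟨hD3, hD4⟩
  have hinert : ∀ (m' : ℕ), m' ∣ c → ∀ q ∈ m'.primeFactors, (Ideal.span {(q : 𝓞 K)}).IsPrime :=
    fun m' hm' q hq ↦ (hcK q (Nat.primeFactors_mono hm' hc.ne_zero hq)).1.2.2.2.2.1
  -- data at every divisor of `c` (the given `d` at `c` itself)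
  have hne : ∀ m' : ℕ, m' ∣ c → Nonempty (KolyvaginHeegnerData Dt β ι m') := fun m' hm' ↦
    nonempty_kolyvaginHeegnerData_of_grossCM hCM1 hCM2 hK hH Dt β ι d.dvd_sq_sub
      (hc.squarefree_of_dvd hm') (hinert m' hm')
  let data : (m' : ℕ) → m' ∣ c → KolyvaginHeegnerData Dt β ι m' := fun m' hm' ↦
    if h : m' = c then h ▸ d else (hne m' hm').some
  have hdata : data c dvd_rfl = d := by simp [data]
  -- Gross Prop. 5.3 at every divisor of `c` (all `≠ 0` and prime to `N`), UNCONDITIONALLY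
  have h53 : ∀ (m : ℕ) (hm : m ∣ c) (τm : ringClassField K ι m ≃ₐ[ℚ] ringClassField K ι m),
      (∀ x : ringClassField K ι m, ((τm x : ringClassField K ι m) : ℂ) = starRingEnd ℂ x) →
      ∃ σ' ∈ ringClassGal ι m, IsOfFinAddOrder
        (pointGalHom W (ringClassField K ι m) τm (data m hm).y -
          (-W.rootNumber) • pointGalHom W (ringClassField K ι m) σ' (data m hm).y) := by
    intro m hm τm hτm
    obtain ⟨hm0, hmN⟩ := ne_zero_and_coprime_of_isKolyvaginPrime (K := K) (hc.squarefree_of_dvd hm)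
      (fun q hq ↦ (hcK q (Nat.primeFactors_mono hm hc.ne_zero hq)).1)
    exact exists_mem_ringClassGal_isOfFinAddOrder_conj_sub_smul W hK hH Dt ι hm0 hmN (data m hm) τm hτm
  -- Prop. 5.4 (2) at Zhang–Kolyvagin levels, admissibility at `2` from `E(ℚ)[2] = 0` (off the habitat)
  have h := conjAct_kolyvaginClass_eq_sign_smul_zhang (c := τ) hK ι Nat.prime_two hk Dt hND hD hc hcK
    data hτ (-W.rootNumber) h53
    (fun m hm ↦ GenusExact.isAdmissible_pointsSubgroup_two_of_torsionBy_eq_bot (data m hm) htorQ hK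
      (ne_zero_of_dvd_ne_zero hc.ne_zero hm) hD4 hH k)
    c dvd_rfl
  rwa [hdata] at h

end OneConductor

/-- **T3 OFF THE HABITAT — complex conjugation acts on the depth-`ν` classes by one sign**: the text
of the habitat stub `stub_conjSign` with the binder `(∀ m, ρ̄_{E,2^m} onto)` replaced by `E(ℚ)[2] = 0`.
For the non-trivial automorphism `σ₀` of `K` and every depth `ν`, `ε = −w(E)·(−1)^ν ∈ {1, −1}` satisfies
`σ₀_* c_M(n) = ε c_M(n)` for all `n ∈ Λ` with `ν` prime factors, every datum `d`, all `1 ≤ M ≤ M(n)`.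
[cite: GrossLMS1991, §5 Prop. 5.3, Prop. 5.4] [cite: McCallumLMS1991, §5 (ε_r = (−1)^r ε)] -/
theorem conjSign_offHabitat :
    ∀ (W : WeierstrassCurve ℚ) [W.IsElliptic] [W.IsGloballyMinimal], ¬ W.HasCM →
      (Rank1Residual.GoodOrd W 2 ∨ Rank1Residual.Mult W 2) →
      AddSubgroup.torsionBy W.toAffine.Point (2 : ℤ) = ⊥ →
      ∀ (K : Type) [Field K] [NumberField K], IsImaginaryQuadratic K → NumberField.discr K ≠ -3 →
      NumberField.discr K ≠ -4 → ¬ ((2 : ℤ) ∣ NumberField.discr K) → ∀ [NeZero (W.conductorNorm ℤ)],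
      SatisfiesHeegnerHypothesis (W.conductorNorm ℤ) K →
      ∀ (Dt : ModularParametrizationData W (W.conductorNorm ℤ)) (β : ℤ) (ι : K →+* ℂ)
        (σ₀ : K ≃ₐ[ℚ] K), σ₀ ≠ 1 → ∀ ν : ℕ, ∃ ε : ℤ, (ε = 1 ∨ ε = -1) ∧
        ∀ (n : ℕ) (d : KolyvaginHeegnerData Dt β ι n) (M : ℕ),
        KolyvaginDescent.KolSupp (Zhang2014.IsKolyvaginPrime (W.conductorNorm ℤ) W K 2) n →
        n.primeFactors.card = ν → 1 ≤ M → (M : ℕ∞) ≤ Zhang2014.levelIndex W 2 n →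
          conjAct W σ₀ ((2 ^ M : ℕ) : ℤ) (d.kolyvaginClass Nat.prime_two M) =
            ε • d.kolyvaginClass Nat.prime_two M := by
  intro W _ _ _ _ htorQ K _ _ hK hne3 hne4 _ _ hHN Dt β ι σ₀ hσ₀1 ν
  refine ⟨-W.rootNumber * (-1) ^ ν, ?_, fun n d M hn hν hM1 hMle ↦ ?_⟩
  · rcases W.rootNumber_eq_one_or with h1 | h1 <;>
      rcases neg_one_pow_eq_or ℤ ν with h | h <;> simp [h1, h]
  · subst hν
    exact conjAct_kolyvaginClass_two_eq_sign_smul_offHabitat htorQ hK hne3 hne4 hHN σ₀ hσ₀1 Dt β ι hn.1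
      hM1 (fun ℓ hℓ ↦ ⟨hn.2 ℓ hℓ, Zhang2014.natCast_le_levelIndex_iff.mp hMle ℓ hℓ⟩) d

end Summit.BirchSwinnertonDyer.BirchSwinnertonDyer.Theorems.KolyvaginLowerBoundAtTwo

end
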